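import Summits.BirchSwinnertonDyer.BirchSwinnertonDyer.Theorems.RamifiedHeegnerPairLeafSigmaStarTightData
import HarnessLib

/-!
# Route `RamifiedHeegnerPair` (rev 9) — the research stub Σ★″ of the lines `splitkolyvagin` v5 (U₁, 26022) /
# `splitkolyvagin0` v4 (U₀, 26024) is TIGHT on the `ρ̄₃`-onto rows — CLASS LEVEL, ORIENTATION-FREE: Σ★″ there FOLLOWS
# from BSD₃ on the leaf (`WAllExclAddGssAtThree`, the statement the route serves) and print, hence from the four member
# items U₁ ∧ L₁ ∧ U₀ ∧ L₀ and print (lead prover bsd-line-rhp-p2 g6; `--supports stmt-BirchSwinnertonDyer-26022`, helper;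
# BSD is not proved by any of this)

Sibling of `RamifiedHeegnerPairLeafSigmaStarTightData.lean` (the two oriented DATA-level theorems
`pDiv_of_bsdp_of_partner_bsdp_rankOne` / `pDiv_of_bsdp_of_partner_bsdp_rankZero`: at one frame, `BSDp E 3 ∧ BSDp Wd 3` forbid
every McCallum certificate beyond the budget `ord₃ ∏c_ℓ(E) + v₃(c)`, by McCallum 1991 Cor. 5.6 against the exact Gross–Zagier
bookkeeping). Here the ORIENTATION is read off the non-torsion Heegner point — `L′(E/K,1) ≠ 0` (Gross–Zagier), so
`r_an(E) + r_an(E^{d_K}) ≤ 1`; Kolyvagin gives `rank E(K) = 1 = rank E + rank E^{d_K}`; GZK turns ranks into analytic ranks —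
and the minimal twist model is again a non-CM leaf curve (`leaf_twist_of_heegner`), so the leaf pays `BSD₃` of BOTH members.

* `sigmaStarOptOffRows_of_wAllExclAddGssAtThree_of_surj` — binders of the registered stub
  `stub_leafSigmaStarDivisibilityAtThreeOptimalOffRows` VERBATIM plus `ρ̄_{E,3}` onto: leaf + print ⟹ `3^{s′} ∣ P_n`. The
  off-rows clause is idle; the lattice-optimal clause pays `3 ∤ c` (Manin facts) in the rank-zero orientation.
* `sigmaStarOptOffRows_of_members_of_surj` — the same from the four route items L₁ (26021), U₁ (26022), L₀ (26023), U₀ (26024)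
  BY NAME (through the route's `closes`). So, modulo {PUB⁺, S2, L₁, L₀} (p622097: Σ★″ ⟹ U₁ ∧ U₀), the research child Σ★″ is
  EQUIVALENT to U₁ ∧ U₀ on the onto rows (257 of the 355 r1 Gss2 classes, N ≤ 5·10⁵): it carries no surplus over BSD₃ there,
  and a counterexample to Σ★″ on an onto row would refute BSD₃ on the leaf. Off the onto rows (98 r1 classes, mod-3 image
  `C_ns⁺(3)`) Kolyvagin's structure theorem is not available and nothing is claimed.
* `sigmaStarOptOffRows_of_sigmaOptOffRows_of_sigmaZeroOptOffRows` — Σ★″ ⟸ Σ″ (U₁'s former v4 stub) ∧ Σ₀″ (U₀'s former v3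
  stub) modulo {Gross–Zagier, Kolyvagin, GZK, modularity}: registering ONE shared child instead of two oriented ones loses
  nothing (converses p622097).
CONDITIONAL on the displayed named facts and on the leaf / the member items taken as hypotheses; nothing asserted.
References: [McCallumLMS1991] §5 Cor. 5.6; [GrossZagier1986] I.(6.3), (7.3), V.(2.2); [Gross1991] (1.1), Thm. 1.3;
[Jetchev2008] Conj. 1.3; [Miller2011LMS] Def. 1.1; [Mazur1978] Cor. 4.1; [AbbesUllmo1996] Thm. A; [Cesnavicius2018] Thm. 1.2.
-/

-- D-0017: single-problem summit, so `Summit.BirchSwinnertonDyer.BirchSwinnertonDyer.…` repeats a namespace BY DESIGN.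
set_option linter.dupNamespace false
set_option autoImplicit false

noncomputable section

open scoped Classical NumberField

open WeierstrassCurve NumberField IsDedekindDomain Literature Literature.NumberTheory.EllipticCurves
  Literature.NumberTheory.EllipticCurves.ModularForms
  Literature.NumberTheory.EllipticCurves.Rank1Residual
  Literature.NumberTheory.EllipticCurves.Rank1Residual.Typed
  Summit.BirchSwinnertonDyer.Rank1Residual
  Summit.BirchSwinnertonDyer.Rank1Residual.Additive
  Summit.BirchSwinnertonDyer.Rank1Residual.X11b
  Summit.BirchSwinnertonDyer.BirchSwinnertonDyer.Theses.RamifiedHeegnerPair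
  Summit.BirchSwinnertonDyer.BirchSwinnertonDyer.Theorems

namespace Summit.BirchSwinnertonDyer.BirchSwinnertonDyer.Theorems.RamifiedPairUpperBound

/-! ## CLASS level, orientation-free: the leaf + print ⟹ Σ★″ on the `ρ̄₃`-onto rows; and from the four members -/

/-- **Σ★″ on the onto rows ⟸ the leaf `WAllExclAddGssAtThree` + print — the research child of U₁/U₀ is TIGHT there.**
Binders of the registered stub `stub_leafSigmaStarDivisibilityAtThreeOptimalOffRows` (skeletons `splitkolyvagin` v5 /
`splitkolyvagin0` v4) VERBATIM, plus `ρ̄_{E,3}` onto (`W.HasSurjectiveModNGaloisRep 3`; on the leaf this is the whole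
`3`-adic tower, `RamifiedPairLowerBound.towerSurj_three_of_subGss_of_surj`). Named facts as hypotheses: Gross–Zagier,
Kolyvagin, GZK, modularity (Version L), Gross–Zagier I.(7.3), Shimura reciprocity at conductor `1`, Darmon Thm. 3.6,
McCallum Cor. 5.6, and — for `3 ∤ c` of the lattice-optimal datum on the `I₀*` fibre — Mazur Cor. 4.1, Abbes–Ullmo Thm. A,
Česnavičius Thm. 1.2, newform of `E`. The ORIENTATION is read off the non-torsion Heegner point: `L′(E/K,1) ≠ 0`
(Gross–Zagier), so `r_an(E) + r_an(E^{d_K}) ≤ 1` (`ShimuraKolyvaginTransport.analyticRank_add_le_one_of_LDerivEK_ne_zero`), while Kolyvagin gives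
`rank E(K) = 1 = rank E + rank E^{d_K}` (`mordellWeilRank_baseChange_quadratic_holds`) and GZK turns ranks into analytic
ranks: exactly one member has analytic rank `1`. The minimal twist model is again a non-CM leaf curve
(`leaf_twist_of_heegner`), so the leaf gives `BSD₃` of BOTH members; the sibling's `pDiv_of_bsdp_of_partner_bsdp_rankOne` /
`pDiv_of_bsdp_of_partner_bsdp_rankZero` finish. The off-rows clause of Σ★″ is idle.
CONDITIONAL on the leaf (a conjecture, hypothesis `hLeaf`) and the named facts; nothing is asserted; BSD is not proved.
[cite: Jetchev2008, Conj. 1.3 (p. 812)] [cite: McCallumLMS1991, §5 Cor. 5.6 (p. 310)] [cite: GrossZagier1986, Thm. I.(6.3), (7.3), V (2.2)]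
[cite: Gross1991, (1.1) and Thm. 1.3] [cite: Mazur1978, Cor. 4.1] [cite: Miller2011LMS, Def. 1.1] -/
theorem sigmaStarOptOffRows_of_wAllExclAddGssAtThree_of_surj
    (hGZ : ∀ (N : ℕ) [NeZero N] (W : WeierstrassCurve ℚ) (K : Type) [Field K] [NumberField K],
      gross_zagier N W K)
    (hKo : ∀ (N : ℕ) [NeZero N] (W : WeierstrassCurve ℚ) (K : Type) [Field K] [NumberField K],
      kolyvagin N W K)
    (hGZK : rank_eq_analyticRank_of_analyticRank_le_one) (hmod : hasEntireLFunction_rat)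
    (hGZ73 : GrossZagier1986_thm_I_7_3)
    (hrec : ∀ (N : ℕ) [NeZero N] (W : WeierstrassCurve ℚ) (K : Type) [Field K] [NumberField K],
      heegnerPointOfConductor_one_galoisConj N W K)
    (h36 : ∀ (N : ℕ) [NeZero N] (W : WeierstrassCurve ℚ) (K : Type) [Field K] [NumberField K],
      phi_heegnerTau_mem_range_map_singularModuliField N W K)
    (hMc : McCallum1991_pow_dvd_card_sha_primary_of_certificate)
    (hM : mazur_not_dvd_maninConstant_of_odd) (hAU : abbesUllmo_not_dvd_maninConstant_of_not_dvd_level)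
    (hC2 : cesnavicius_not_two_dvd_maninConstant_of_two_dvd_level) (hnf : exists_isNewformOf)
    (hLeaf : Summit.BirchSwinnertonDyer.WAllExclAddGssAtThree)
    (W : WeierstrassCurve ℚ) [W.IsElliptic] [W.IsGloballyMinimal] (N : ℕ) [NeZero N]
    (K : Type) [Field K] [NumberField K]
    (Dt : Literature.NumberTheory.EllipticCurves.ModularForms.ModularParametrizationData W N)
    (H : Literature.NumberTheory.EllipticCurves.HeegnerDatum N (NumberField.discr K)) (ι : K →+* ℂ)
    (P : (W.baseChange K).toAffine.Point)
    (hCM : ¬ W.HasCM) (hadd : Literature.NumberTheory.EllipticCurves.Rank1Residual.Addv W 3)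
    (hsub : Summit.BirchSwinnertonDyer.Rank1Residual.Additive.SubGss W 3) (hN : W.conductorNorm ℤ = N)
    (hopt : ∀ z ∈ Dt.L.lattice, ∃ w ∈ Literature.NumberTheory.EllipticCurves.ModularForms.periodLattice Dt.f, z = Dt.c * w)
    (_hrow : ¬ ((∃ (q : ℕ) (_ : Fact q.Prime), q ∣ N ∧ ¬ q ^ 2 ∣ N ∧
        padicValNat 3 W.tamagawaProduct ≤ padicValNat 3 ((W.baseChange ℚ_[q]).localTamagawaNumber ℤ_[q])) ∧
      (∀ (q' : ℕ) [Fact q'.Prime], q' ∣ N →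
        3 ∣ (W.baseChange ℚ_[q']).localTamagawaNumber ℤ_[q'] → ¬ q' ^ 2 ∣ N)))
    (hK : Literature.NumberTheory.EllipticCurves.IsImaginaryQuadratic K)
    (hHN : Literature.NumberTheory.EllipticCurves.SatisfiesHeegnerHypothesis N K)
    (hP : (WeierstrassCurve.Affine.Point.map ι.toRatAlgHom) P =
      Literature.NumberTheory.EllipticCurves.ModularForms.heegnerPointComplex Dt H)
    (hnt : ¬ IsOfFinAddOrder P) (hodd : Odd (NumberField.discr K))
    (hsurj : W.HasSurjectiveModNGaloisRep 3)
    (s' : ℕ) (hs' : s' ≤ padicValNat 3 W.tamagawaProduct + padicValNat 3 Dt.c.natAbs)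
    (n : ℕ) (d : Literature.NumberTheory.EllipticCurves.KolyvaginHeegnerData Dt H.β ι n) (hn : Squarefree n)
    (hℓ : ∀ ℓ ∈ n.primeFactors, Literature.NumberTheory.EllipticCurves.Zhang2014.IsKolyvaginPrime N W K 3 ℓ ∧
      s' ≤ Literature.NumberTheory.EllipticCurves.Zhang2014.kolyvaginIndex W 3 ℓ) :
    Summit.BirchSwinnertonDyer.Rank1Residual.X11b.Three.Koly.PDiv d 3 s' := by
  haveI h3p : Fact (Nat.Prime 3) := ⟨Nat.prime_three⟩
  have h3N : 3 ∣ W.conductorNorm ℤ :=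
    (W.dvd_conductorNorm_iff_not_hasGoodReductionAtPrime 3).mpr (not_good_of_addv W 3 hadd)
  have hHN' : SatisfiesHeegnerHypothesis (W.conductorNorm ℤ) K := by rw [hN]; exact hHN
  -- the `3`-adic tower is onto on the leaf
  have htower : ∀ m : ℕ, W.HasSurjectiveModNGaloisRep (3 ^ m : ℕ) :=
    RamifiedPairLowerBound.towerSurj_three_of_subGss_of_surj W hadd hsub hsurj
  -- a globally minimal model of the twist: again a non-CM leaf curve
  have hD0 : (NumberField.discr K : ℚ) ≠ 0 := by exact_mod_cast NumberField.discr_ne_zero K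
  haveI : (W.quadraticTwist (NumberField.discr K : ℚ)).IsElliptic := W.isElliptic_quadraticTwist hD0
  obtain ⟨Cd, hCd⟩ := hasGlobalMinimalModel_rat_holds (W.quadraticTwist (NumberField.discr K : ℚ))
  haveI : (Cd • W.quadraticTwist (NumberField.discr K : ℚ)).IsGloballyMinimal := hCd
  set Wd := Cd • W.quadraticTwist (NumberField.discr K : ℚ) with hWd_def
  obtain ⟨hCMd, haddd, hsubd, -⟩ := leaf_twist_of_heegner W hCM hadd hsub K hK hHN' hodd Wd Cd rfl
  have hrdt : Wd.analyticRank = (W.quadraticTwist (NumberField.discr K : ℚ)).analyticRank :=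
    WeierstrassCurve.analyticRank_smul (W.quadraticTwist (NumberField.discr K : ℚ)) Cd
  -- the orientation: exactly one member has analytic rank one
  have hLK : LDerivEK W K ≠ 0 :=
    (lDerivEK_ne_zero_iff_not_isOfFinAddOrder W N K (hGZ N W K) hK hHN ⟨Dt, H, ι, hP⟩).mpr hnt
  have hsum : W.analyticRank + (W.quadraticTwist (NumberField.discr K : ℚ)).analyticRank ≤ 1 :=
    ShimuraKolyvaginTransport.analyticRank_add_le_one_of_LDerivEK_ne_zero W K hmod hLK
  have hrW : W.analyticRank ≤ 1 := by omega
  have hrWd : Wd.analyticRank ≤ 1 := by omega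
  obtain ⟨hrankK, -⟩ := hKo N W K hK hHN ⟨Dt, H, ι, hP⟩ hnt
  have hsplit := mordellWeilRank_baseChange_quadratic_holds W K hK.1
  have hrkW : W.mordellWeilRank = W.analyticRank := (hGZK W hrW).1
  have hrkWd : Wd.mordellWeilRank = Wd.analyticRank := (hGZK Wd hrWd).1
  have hrkWd' : Wd.mordellWeilRank = (W.quadraticTwist (NumberField.discr K : ℚ)).mordellWeilRank :=
    WeierstrassCurve.mordellWeilRank_variableChange_holds (W.quadraticTwist (NumberField.discr K : ℚ)) Cd
  have hone : W.analyticRank + Wd.analyticRank = 1 := by omega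
  -- BSD₃ of both members from the leaf
  have hBW : BSDp W 3 := hLeaf W hCM hadd hsub hrW
  have hBWd : BSDp Wd 3 := hLeaf Wd hCMd haddd hsubd hrWd
  rcases Nat.eq_zero_or_pos W.analyticRank with hr0 | hr1
  · -- rank-ZERO orientation: `3 ∤ c` for the lattice-optimal datum on the `I₀*` fibre
    have hrd : Wd.analyticRank = 1 := by omega
    have hc : ¬ (3 : ℤ) ∣ Dt.c := not_three_dvd_c_of_latticeOptimal_of_subGss hM hAU hC2 hnf W Dt hopt hadd hsub
    exact pDiv_of_bsdp_of_partner_bsdp_rankZero hGZ hKo hGZK hmod hrec h36 hMc W N K Dt H ι P hCM h3N hN htower hK hHN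
      hodd hr0 hP hnt hc Wd Cd rfl hrd hBW hBWd hs' d hn hℓ
  · -- rank-ONE orientation
    have hr : W.analyticRank = 1 := by omega
    have hrd : Wd.analyticRank = 0 := by omega
    have hLt : (W.quadraticTwist (NumberField.discr K : ℚ)).entireLFunction 1 ≠ 0 :=
      (analyticRank_eq_zero_iff_L_one_ne_zero_of_hasEntireLFunction_rat hmod _).mp (hrdt ▸ hrd)
    exact pDiv_of_bsdp_of_partner_bsdp_rankOne hGZ hKo hGZK hmod hGZ73 hrec h36 hMc W N K Dt H ι P hCM h3N hN htower hK
      hHN hodd hr hLt hP Wd Cd rfl hBW hBWd hs' d hn hℓ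

/-- **Σ★″ on the onto rows ⟸ the four MEMBER items + print.** The route's `closes` (GZK + L₁ + U₁ + L₀ + U₀ ⟹ the leaf
`WAllExclAddGssAtThree`) composed with `sigmaStarOptOffRows_of_wAllExclAddGssAtThree_of_surj`: with p622097 (PUB★⁺ → S2 → Σ★″ →
L₁ → L₀ → leaf) this makes Σ★″|onto and (U₁ ∧ U₀)|onto EQUIVALENT modulo {PUB★⁺, S2, L₁, L₀}. Items BY NAME as hypotheses;
CONDITIONAL; nothing asserted; BSD is not proved. [cite: Jetchev2008, Conj. 1.3 (p. 812)] [cite: McCallumLMS1991, §5 Cor. 5.6 (p. 310)]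
[cite: GrossZagier1986, Thm. I.(6.3), (7.3), V (2.2)] [cite: Miller2011LMS, Def. 1.1] -/
theorem sigmaStarOptOffRows_of_members_of_surj
    (hGZ : ∀ (N : ℕ) [NeZero N] (W : WeierstrassCurve ℚ) (K : Type) [Field K] [NumberField K],
      gross_zagier N W K)
    (hKo : ∀ (N : ℕ) [NeZero N] (W : WeierstrassCurve ℚ) (K : Type) [Field K] [NumberField K],
      kolyvagin N W K)
    (hGZK : rank_eq_analyticRank_of_analyticRank_le_one) (hmod : hasEntireLFunction_rat)
    (hGZ73 : GrossZagier1986_thm_I_7_3)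
    (hrec : ∀ (N : ℕ) [NeZero N] (W : WeierstrassCurve ℚ) (K : Type) [Field K] [NumberField K],
      heegnerPointOfConductor_one_galoisConj N W K)
    (h36 : ∀ (N : ℕ) [NeZero N] (W : WeierstrassCurve ℚ) (K : Type) [Field K] [NumberField K],
      phi_heegnerTau_mem_range_map_singularModuliField N W K)
    (hMc : McCallum1991_pow_dvd_card_sha_primary_of_certificate)
    (hM : mazur_not_dvd_maninConstant_of_odd) (hAU : abbesUllmo_not_dvd_maninConstant_of_not_dvd_level)
    (hC2 : cesnavicius_not_two_dvd_maninConstant_of_two_dvd_level) (hnf : exists_isNewformOf)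
    (hL1 : Gss2LowerAtThreeRankOne) (hU1 : LeafRankOneUpperAtThree) (hL0 : Gss2LowerAtThreeRankZero)
    (hU0 : LeafRankZeroUpperAtThree)
    (W : WeierstrassCurve ℚ) [W.IsElliptic] [W.IsGloballyMinimal] (N : ℕ) [NeZero N]
    (K : Type) [Field K] [NumberField K]
    (Dt : Literature.NumberTheory.EllipticCurves.ModularForms.ModularParametrizationData W N)
    (H : Literature.NumberTheory.EllipticCurves.HeegnerDatum N (NumberField.discr K)) (ι : K →+* ℂ)
    (P : (W.baseChange K).toAffine.Point)
    (hCM : ¬ W.HasCM) (hadd : Literature.NumberTheory.EllipticCurves.Rank1Residual.Addv W 3)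
    (hsub : Summit.BirchSwinnertonDyer.Rank1Residual.Additive.SubGss W 3) (hN : W.conductorNorm ℤ = N)
    (hopt : ∀ z ∈ Dt.L.lattice, ∃ w ∈ Literature.NumberTheory.EllipticCurves.ModularForms.periodLattice Dt.f, z = Dt.c * w)
    (hrow : ¬ ((∃ (q : ℕ) (_ : Fact q.Prime), q ∣ N ∧ ¬ q ^ 2 ∣ N ∧
        padicValNat 3 W.tamagawaProduct ≤ padicValNat 3 ((W.baseChange ℚ_[q]).localTamagawaNumber ℤ_[q])) ∧
      (∀ (q' : ℕ) [Fact q'.Prime], q' ∣ N →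
        3 ∣ (W.baseChange ℚ_[q']).localTamagawaNumber ℤ_[q'] → ¬ q' ^ 2 ∣ N)))
    (hK : Literature.NumberTheory.EllipticCurves.IsImaginaryQuadratic K)
    (hHN : Literature.NumberTheory.EllipticCurves.SatisfiesHeegnerHypothesis N K)
    (hP : (WeierstrassCurve.Affine.Point.map ι.toRatAlgHom) P =
      Literature.NumberTheory.EllipticCurves.ModularForms.heegnerPointComplex Dt H)
    (hnt : ¬ IsOfFinAddOrder P) (hodd : Odd (NumberField.discr K))
    (hsurj : W.HasSurjectiveModNGaloisRep 3)
    (s' : ℕ) (hs' : s' ≤ padicValNat 3 W.tamagawaProduct + padicValNat 3 Dt.c.natAbs)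
    (n : ℕ) (d : Literature.NumberTheory.EllipticCurves.KolyvaginHeegnerData Dt H.β ι n) (hn : Squarefree n)
    (hℓ : ∀ ℓ ∈ n.primeFactors, Literature.NumberTheory.EllipticCurves.Zhang2014.IsKolyvaginPrime N W K 3 ℓ ∧
      s' ≤ Literature.NumberTheory.EllipticCurves.Zhang2014.kolyvaginIndex W 3 ℓ) :
    Summit.BirchSwinnertonDyer.Rank1Residual.X11b.Three.Koly.PDiv d 3 s' :=
  sigmaStarOptOffRows_of_wAllExclAddGssAtThree_of_surj hGZ hKo hGZK hmod hGZ73 hrec h36 hMc hM hAU hC2 hnf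
    (closes hGZK hL1 hU1 hL0 hU0) W N K Dt H ι P hCM hadd hsub hN hopt hrow hK hHN hP hnt hodd hsurj s' hs' n d hn hℓ

/-! ## The shared child against the two oriented children: Σ★″ ⟸ Σ″ ∧ Σ₀″ modulo print -/

/-- **Σ★″ ⟸ Σ″ ∧ Σ₀″ modulo print — the shared child loses nothing against the two oriented children.** The registered
orientation-free stub Σ★″ (`stub_leafSigmaStarDivisibilityAtThreeOptimalOffRows`) follows from U₁'s former v4 stub Σ″
(rank-one orientation: `r_an(E) = 1`, `L(E^{d_K},1) ≠ 0`) and U₀'s former v3 stub Σ₀″ (rank-zero orientation: `r_an(E) = 0`,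
`L(E^{d_K},s)` with a simple zero at `1`), given Gross–Zagier, Kolyvagin, GZK and modularity: the non-torsion Heegner point
gives `L′(E/K,1) ≠ 0`, so `r_an(E) + r_an(E^{d_K}) ≤ 1`, while `rank E(K) = 1 = rank E + rank E^{d_K}` and GZK make the sum
exactly `1`. (Converses: `sigmaOptOffRows_of_sigmaStarOptOffRows`, `sigmaZeroOptOffRows_of_sigmaStarOptOffRows`, p622097.)
CONDITIONAL; nothing asserted. [cite: Jetchev2008, Conj. 1.3 (p. 812)] [cite: Gross1991, (1.1) and Thm. 1.3]
[cite: GrossZagier1986, Thm. I.(6.3)] -/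
theorem sigmaStarOptOffRows_of_sigmaOptOffRows_of_sigmaZeroOptOffRows
    (hGZ : ∀ (N : ℕ) [NeZero N] (W : WeierstrassCurve ℚ) (K : Type) [Field K] [NumberField K],
      gross_zagier N W K)
    (hKo : ∀ (N : ℕ) [NeZero N] (W : WeierstrassCurve ℚ) (K : Type) [Field K] [NumberField K],
      kolyvagin N W K)
    (hGZK : rank_eq_analyticRank_of_analyticRank_le_one) (hmod : hasEntireLFunction_rat)
    (hSig : ∀ (W : WeierstrassCurve ℚ) [W.IsElliptic] [W.IsGloballyMinimal] (N : ℕ) [NeZero N]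
      (K : Type) [Field K] [NumberField K]
      (Dt : Literature.NumberTheory.EllipticCurves.ModularForms.ModularParametrizationData W N)
      (H : Literature.NumberTheory.EllipticCurves.HeegnerDatum N (NumberField.discr K)) (ι : K →+* ℂ)
      (P : (W.baseChange K).toAffine.Point),
      ¬ W.HasCM → Literature.NumberTheory.EllipticCurves.Rank1Residual.Addv W 3 →
      Summit.BirchSwinnertonDyer.Rank1Residual.Additive.SubGss W 3 → W.analyticRank = 1 →
      W.conductorNorm ℤ = N →
      (∀ z ∈ Dt.L.lattice, ∃ w ∈ Literature.NumberTheory.EllipticCurves.ModularForms.periodLattice Dt.f, z = Dt.c * w) →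
      ¬ ((∃ (q : ℕ) (_ : Fact q.Prime), q ∣ N ∧ ¬ q ^ 2 ∣ N ∧
      padicValNat 3 W.tamagawaProduct ≤ padicValNat 3 ((W.baseChange ℚ_[q]).localTamagawaNumber ℤ_[q])) ∧
      (∀ (q' : ℕ) [Fact q'.Prime], q' ∣ N →
      3 ∣ (W.baseChange ℚ_[q']).localTamagawaNumber ℤ_[q'] → ¬ q' ^ 2 ∣ N)) →
      Literature.NumberTheory.EllipticCurves.IsImaginaryQuadratic K →
      Literature.NumberTheory.EllipticCurves.SatisfiesHeegnerHypothesis N K →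
      (W.quadraticTwist (NumberField.discr K : ℚ)).entireLFunction 1 ≠ 0 →
      (WeierstrassCurve.Affine.Point.map ι.toRatAlgHom) P =
      Literature.NumberTheory.EllipticCurves.ModularForms.heegnerPointComplex Dt H →
      ¬ IsOfFinAddOrder P → Odd (NumberField.discr K) →
      ∀ (s' : ℕ), s' ≤ padicValNat 3 W.tamagawaProduct + padicValNat 3 Dt.c.natAbs →
      ∀ (n : ℕ) (d : Literature.NumberTheory.EllipticCurves.KolyvaginHeegnerData Dt H.β ι n), Squarefree n →
      (∀ ℓ ∈ n.primeFactors, Literature.NumberTheory.EllipticCurves.Zhang2014.IsKolyvaginPrime N W K 3 ℓ ∧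
      s' ≤ Literature.NumberTheory.EllipticCurves.Zhang2014.kolyvaginIndex W 3 ℓ) →
      Summit.BirchSwinnertonDyer.Rank1Residual.X11b.Three.Koly.PDiv d 3 s')
    (hSig0 : ∀ (W : WeierstrassCurve ℚ) [W.IsElliptic] [W.IsGloballyMinimal] (N : ℕ) [NeZero N]
      (K : Type) [Field K] [NumberField K]
      (Dt : Literature.NumberTheory.EllipticCurves.ModularForms.ModularParametrizationData W N)
      (H : Literature.NumberTheory.EllipticCurves.HeegnerDatum N (NumberField.discr K)) (ι : K →+* ℂ)
      (P : (W.baseChange K).toAffine.Point),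
      ¬ W.HasCM → Literature.NumberTheory.EllipticCurves.Rank1Residual.Addv W 3 →
      Summit.BirchSwinnertonDyer.Rank1Residual.Additive.SubGss W 3 → W.analyticRank = 0 →
      W.conductorNorm ℤ = N →
      (∀ z ∈ Dt.L.lattice, ∃ w ∈ Literature.NumberTheory.EllipticCurves.ModularForms.periodLattice Dt.f, z = Dt.c * w) →
      ¬ ((∃ (q : ℕ) (_ : Fact q.Prime), q ∣ N ∧ ¬ q ^ 2 ∣ N ∧
      padicValNat 3 W.tamagawaProduct ≤ padicValNat 3 ((W.baseChange ℚ_[q]).localTamagawaNumber ℤ_[q])) ∧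
      (∀ (q' : ℕ) [Fact q'.Prime], q' ∣ N →
      3 ∣ (W.baseChange ℚ_[q']).localTamagawaNumber ℤ_[q'] → ¬ q' ^ 2 ∣ N)) →
      Literature.NumberTheory.EllipticCurves.IsImaginaryQuadratic K →
      Literature.NumberTheory.EllipticCurves.SatisfiesHeegnerHypothesis N K →
      (W.quadraticTwist (NumberField.discr K : ℚ)).entireLFunction 1 = 0 →
      deriv (W.quadraticTwist (NumberField.discr K : ℚ)).entireLFunction 1 ≠ 0 →
      (WeierstrassCurve.Affine.Point.map ι.toRatAlgHom) P =
      Literature.NumberTheory.EllipticCurves.ModularForms.heegnerPointComplex Dt H →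
      ¬ IsOfFinAddOrder P → Odd (NumberField.discr K) →
      ∀ (s' : ℕ), s' ≤ padicValNat 3 W.tamagawaProduct + padicValNat 3 Dt.c.natAbs →
      ∀ (n : ℕ) (d : Literature.NumberTheory.EllipticCurves.KolyvaginHeegnerData Dt H.β ι n), Squarefree n →
      (∀ ℓ ∈ n.primeFactors, Literature.NumberTheory.EllipticCurves.Zhang2014.IsKolyvaginPrime N W K 3 ℓ ∧
      s' ≤ Literature.NumberTheory.EllipticCurves.Zhang2014.kolyvaginIndex W 3 ℓ) →
      Summit.BirchSwinnertonDyer.Rank1Residual.X11b.Three.Koly.PDiv d 3 s') :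
    ∀ (W : WeierstrassCurve ℚ) [W.IsElliptic] [W.IsGloballyMinimal] (N : ℕ) [NeZero N]
      (K : Type) [Field K] [NumberField K]
      (Dt : Literature.NumberTheory.EllipticCurves.ModularForms.ModularParametrizationData W N)
      (H : Literature.NumberTheory.EllipticCurves.HeegnerDatum N (NumberField.discr K)) (ι : K →+* ℂ)
      (P : (W.baseChange K).toAffine.Point),
      ¬ W.HasCM → Literature.NumberTheory.EllipticCurves.Rank1Residual.Addv W 3 →
      Summit.BirchSwinnertonDyer.Rank1Residual.Additive.SubGss W 3 → W.conductorNorm ℤ = N →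
      (∀ z ∈ Dt.L.lattice, ∃ w ∈ Literature.NumberTheory.EllipticCurves.ModularForms.periodLattice Dt.f, z = Dt.c * w) →
      ¬ ((∃ (q : ℕ) (_ : Fact q.Prime), q ∣ N ∧ ¬ q ^ 2 ∣ N ∧
      padicValNat 3 W.tamagawaProduct ≤ padicValNat 3 ((W.baseChange ℚ_[q]).localTamagawaNumber ℤ_[q])) ∧
      (∀ (q' : ℕ) [Fact q'.Prime], q' ∣ N →
      3 ∣ (W.baseChange ℚ_[q']).localTamagawaNumber ℤ_[q'] → ¬ q' ^ 2 ∣ N)) →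
      Literature.NumberTheory.EllipticCurves.IsImaginaryQuadratic K →
      Literature.NumberTheory.EllipticCurves.SatisfiesHeegnerHypothesis N K →
      (WeierstrassCurve.Affine.Point.map ι.toRatAlgHom) P =
      Literature.NumberTheory.EllipticCurves.ModularForms.heegnerPointComplex Dt H →
      ¬ IsOfFinAddOrder P → Odd (NumberField.discr K) →
      ∀ (s' : ℕ), s' ≤ padicValNat 3 W.tamagawaProduct + padicValNat 3 Dt.c.natAbs →
      ∀ (n : ℕ) (d : Literature.NumberTheory.EllipticCurves.KolyvaginHeegnerData Dt H.β ι n), Squarefree n →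
      (∀ ℓ ∈ n.primeFactors, Literature.NumberTheory.EllipticCurves.Zhang2014.IsKolyvaginPrime N W K 3 ℓ ∧
      s' ≤ Literature.NumberTheory.EllipticCurves.Zhang2014.kolyvaginIndex W 3 ℓ) →
      Summit.BirchSwinnertonDyer.Rank1Residual.X11b.Three.Koly.PDiv d 3 s' := by
  intro W _ _ N _ K _ _ Dt H ι P hCM hadd hsub hN hopt hrow hK hHN hP hnt hodd s' hs' n d hn hℓ
  have hD0 : (NumberField.discr K : ℚ) ≠ 0 := by exact_mod_cast NumberField.discr_ne_zero K
  haveI : (W.quadraticTwist (NumberField.discr K : ℚ)).IsElliptic := W.isElliptic_quadraticTwist hD0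
  -- the orientation from the non-torsion Heegner point
  have hLK : LDerivEK W K ≠ 0 :=
    (lDerivEK_ne_zero_iff_not_isOfFinAddOrder W N K (hGZ N W K) hK hHN ⟨Dt, H, ι, hP⟩).mpr hnt
  have hsum : W.analyticRank + (W.quadraticTwist (NumberField.discr K : ℚ)).analyticRank ≤ 1 :=
    ShimuraKolyvaginTransport.analyticRank_add_le_one_of_LDerivEK_ne_zero W K hmod hLK
  obtain ⟨hrankK, -⟩ := hKo N W K hK hHN ⟨Dt, H, ι, hP⟩ hnt
  have hsplit := mordellWeilRank_baseChange_quadratic_holds W K hK.1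
  have hrkW : W.mordellWeilRank = W.analyticRank := (hGZK W (by omega)).1
  have hrkWt : (W.quadraticTwist (NumberField.discr K : ℚ)).mordellWeilRank =
      (W.quadraticTwist (NumberField.discr K : ℚ)).analyticRank := (hGZK _ (by omega)).1
  rcases Nat.eq_zero_or_pos W.analyticRank with hr0 | hr1
  · -- rank-ZERO orientation: the twisted `L`-series has a simple zero at `1`
    have hrt : (W.quadraticTwist (NumberField.discr K : ℚ)).analyticRank = 1 := by omega
    have hL0 := entireLFunction_one_eq_zero_of_analyticRank_eq_one hrt
    obtain ⟨-, hL1⟩ := leadingLCoeff_eq_deriv_of_analyticRank_eq_one hrt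
    exact hSig0 W N K Dt H ι P hCM hadd hsub hr0 hN hopt hrow hK hHN hL0 hL1 hP hnt hodd s' hs' n d hn hℓ
  · -- rank-ONE orientation: the twisted central value is non-zero
    have hr : W.analyticRank = 1 := by omega
    have hrt : (W.quadraticTwist (NumberField.discr K : ℚ)).analyticRank = 0 := by omega
    have hLt : (W.quadraticTwist (NumberField.discr K : ℚ)).entireLFunction 1 ≠ 0 :=
      (analyticRank_eq_zero_iff_L_one_ne_zero_of_hasEntireLFunction_rat hmod _).mp hrt
    exact hSig W N K Dt H ι P hCM hadd hsub hr hN hopt hrow hK hHN hLt hP hnt hodd s' hs' n d hn hℓ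

end Summit.BirchSwinnertonDyer.BirchSwinnertonDyer.Theorems.RamifiedPairUpperBound

end
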